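import Summits.ResolutionOfSingularities.ResolutionOfSingularities.Theorems.PurelyInseparableDim4ResConeCInfCornerTailPrime
import Summits.ResolutionOfSingularities.ResolutionOfSingularities.Theorems.PurelyInseparableDim4ResConeCInfWindowToolsPrime
import Summits.ResolutionOfSingularities.ResolutionOfSingularities.Theorems.PurelyInseparableDim4ResConeCInfFrameTools
import HarnessLib
import HarnessLib.Audit.Tags

/-!
# Purely inseparable four-folds — C∞ FRAME TOOLS FOR EVERY PRIME: straight residual cones (readings ⇄ `resForm = a·x_f^d`,
# every vertex form of the package is straight) and the ENTRY OF A PURE CORNER STEP (straightness + exact ledger ride) at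
# `(p, p − 1)` (cell `res-dim4-pi`, K2(p) lane, rung-1 power-cone line «light pair of TAIL(p, p−1, 3) ∀ p», ENTRY-1)

[OURS · counted 0 · cell `res-dim4-pi` · K2(p) lane (holder res-dim4-p-12 g5, line booked g5-2 (6)); the `(5,4)` instance is
res-dim4-p-3 g4's `…ResConeCInfFrameTools` (§2–§3; its §1 `exists_reframed_chain_full (p)` is already p-generic and is NOT
restated); seat res-dim4-p-3 g5.]  Nothing here proves K2(p) for any `p`, any TAIL(p, p−1, 3), `NoIsolatedTrap p p`, the
Cossart–Jannsen–Saito theorem or resolution of singularities in dimension ≥ 4 / characteristic `p` — NOT proved.  AI kernel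
work, weaker than expert review.  ENTRY bookkeeping for the typ-1 lineage's window half; kills nothing by itself.

* `resForm_eq_C_mul_X_pow_of_readings_prime` — `ord₀ F = d + 2`, `|r| = 2`, `coeff_{r + d·e_f} F = a`, the other residual
  degree-`d` readings vanish ⇒ `resForm s = a·x_f^d` (converse of FILE 4's `straight_readings_of_resForm_prime`).
* `straight_of_resForm_eq_prime` — `resForm s = a′·L^d = a·x_f^d`, `a ≠ 0`, `d + 1 = p` ⇒ `ℓ_i = 0` off `f`
  (`(d : K) ≠ 0` for `(4 : K) ≠ 0`; FILE 1's `linearForm_off_eq_zero_pow`).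
* **`cInf_entry_of_corner_prime`** — ENTRY OF A PURE CORNER SLOT STEP: a STRAIGHT parent (`resForm = a·x_f^d`, `a ≠ 0`, order
  `d + 2`, ledger `e_κ + e_o`, `x^r ∣ F`) with the EXACT pair-ledger support form and a child of order `d + 2` with `e_G = 3` and
  `r′ = r` give: the child is straight with the SAME coefficient (FILE 1 (i)(ii)) and carries the exact ledger (FILE 2
  `ledger_step_zero_prime`).  The `u`-axis FLAG conjuncts of the `(5,4)` statement ((D3), typ-1's `cInf_uFlag_of_child'`) are
  NOT here: they follow from the typ-1 lineage's `…CInfUFlagPrime` (W7) and FILE 4's `cInf_uFlag_step_zero_prime`.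
[cite: CossartJannsenSaito2020, Thm. 3.14, Lemma 13.2] [cite: Hauser2010, §§F–G]
bears_on: LADDER-RESOLUTION:D157-DOOR2 (res-dim4-pi · K2(p) · power cones · C∞ frame tools every prime).  Supports
stmt-ResolutionOfSingularities-16155 (helper).
-/

set_option linter.dupNamespace false -- mandated namespace of this single-conjunct summit

noncomputable section

namespace Summit.ResolutionOfSingularities.ResolutionOfSingularities.Theorems.PIDim4

namespace ResCone

open MvPolynomial Finset
open Literature.AlgebraicGeometry.Resolution
open Literature.AlgebraicGeometry.Resolution.CentreBlowup
open Literature.AlgebraicGeometry.Resolution.Hauser2010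
open Literature.AlgebraicGeometry.Resolution.HauserPerlega2019

variable {K : Type} [Field K]

/-! ## §1 Straight residual cones, every degree -/

/-- **Readings give back the straight cone** (any `d`): `ord₀ F = d + 2`, `|r| = 2`, `coeff_{r + d·e_f} F = a` and the other
residual degree-`d` readings vanish ⇒ `resForm s = a·x_f^d`. [OURS · bookkeeping] -/
theorem resForm_eq_C_mul_X_pow_of_readings_prime {f : Fin 4} {s : State K} {d : ℕ} (ho : ordZero s.F = ((d + 2 : ℕ) : ℕ∞))
    (hrdeg : s.r.degree = 2) {a : K} (ha : coeff (s.r + Finsupp.single f d) s.F = a)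
    (hstraight : ∀ m : Fin 4 →₀ ℕ, m.degree = d → m ≠ Finsupp.single f d → coeff (s.r + m) s.F = 0) :
    resForm s = C a * X f ^ d := by
  classical
  have hhom := resForm_isHomogeneous (s := s) ho
  rw [hrdeg, show d + 2 - 2 = d from by omega] at hhom
  ext m
  rw [X_pow_eq_monomial, C_mul_monomial, mul_one, coeff_monomial]
  by_cases hm : m.degree = d
  · rw [coeff_resForm, NarrowApolarity.coeff_initialForm_of_degree_eq ho (by rw [map_add, hrdeg, hm]; ring)]
    by_cases hmf : m = Finsupp.single f d
    · rw [hmf, if_pos rfl]; exact ha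
    · rw [if_neg (Ne.symm hmf)]; exact hstraight m hm hmf
  · rw [if_neg (fun h => hm (by rw [← h, Finsupp.degree_single]))]
    by_contra hne
    exact hm (by have := hhom hne; rwa [weight_one_eq_degree] at this)

/-- **A straight residual cone makes every vertex form of the package straight, every prime**: if `resForm s = a′·(Σ ℓᵢ xᵢ)^d`
and also `= a·x_f^d` with `a ≠ 0` and `d + 1 = p`, then `ℓ_i = 0` for `i ≠ f` (`(d : K) ≠ 0` since `p ∤ d`). [OURS · bookkeeping] -/
theorem straight_of_resForm_eq_prime (p : ℕ) [Fact p.Prime] [CharP K p] {d : ℕ} (hdp : d + 1 = p) (hd1 : 1 ≤ d)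
    {f : Fin 4} {s : State K} {a a' : K} {ℓ : Fin 4 → K} (ha : a ≠ 0)
    (hform : resForm s = C a' * (∑ i, C (ℓ i) * X i) ^ d) (hstr : resForm s = C a * X f ^ d) :
    ∀ i, i ≠ f → ℓ i = 0 := by
  classical
  have hdK : (d : K) ≠ 0 := fun h => by
    have hdvd := (CharP.cast_eq_zero_iff K p d).mp h
    have := Nat.le_of_dvd (by omega) hdvd
    omega
  have heq : C a' * (∑ i, C (ℓ i) * X i) ^ d = C a * X f ^ d := by rw [← hform, hstr]
  refine linearForm_off_eq_zero_pow (ℓ := ℓ) (c := a') f hdK ?_ ?_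
  · rw [heq, X_pow_eq_monomial, C_mul_monomial, mul_one, coeff_monomial, if_pos rfl]; exact ha
  · intro i hi
    rw [heq, X_pow_eq_monomial, C_mul_monomial, mul_one, coeff_monomial, if_neg]
    intro h
    have := DFunLike.congr_fun h i
    rw [Finsupp.single_eq_of_ne hi, Finsupp.add_apply, Finsupp.single_eq_same, Finsupp.single_eq_of_ne hi] at this
    omega

/-! ## §2 The entry of a pure corner slot step: straightness and the exact ledger ride along, every prime -/

section Entry

variable [DecidableEq K]
variable {κ o u f : Fin 4} (hκo : κ ≠ o) (hκu : κ ≠ u) (hκf : κ ≠ f) (hou : o ≠ u) (hof : o ≠ f) (huf : u ≠ f)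
include hκo hκu hκf hou hof huf

omit hκu hou huf in
/-- **ENTRY OF A PURE CORNER STEP, every prime** (`d + 1 = p`, `2 ≤ d`) in a slot chart `κ` (`r = e_κ + e_o`): from a STRAIGHT
parent (`resForm = a·x_f^d`, `a ≠ 0`, order `d + 2`, `x^r ∣ F`) carrying the EXACT pair-ledger support form («`x_f`-degree
`≤ d − 1` ⇒ `x_κ², x_o² ∣`»), to a child `s′ = step p univ κ 0 s` of order `d + 2` with `e_G = 3` and `r′ = r`: the child is
straight with the SAME coefficient and carries the exact pair ledger. [OURS] [cite: CossartJannsenSaito2020, Thm. 3.14, Lemma 13.2] -/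
theorem cInf_entry_of_corner_prime (p : ℕ) [Fact p.Prime] [CharP K p] {d : ℕ} (hdp : d + 1 = p) (hd2 : 2 ≤ d)
    {s : State K} (hr : s.r = Finsupp.single κ 1 + Finsupp.single o 1)
    (hdiv : ∀ e ∈ s.F.support, s.r ≤ e) (ho : ordZero s.F = ((d + 2 : ℕ) : ℕ∞)) {a : K} (ha : a ≠ 0)
    (hform : resForm s = C a * X f ^ d)
    (hled : ∀ e ∈ s.F.support, e f ≤ d - 1 → 2 ≤ e κ ∧ 2 ≤ e o)
    (ho' : ordZero (CentreBlowup.step p Finset.univ κ 0 s).F = ((d + 2 : ℕ) : ℕ∞))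
    (he3' : Module.finrank K (resVertex (CentreBlowup.step p Finset.univ κ 0 s)) = 3)
    (hr' : (CentreBlowup.step p Finset.univ κ 0 s).r = Finsupp.single κ 1 + Finsupp.single o 1) :
    resForm (CentreBlowup.step p Finset.univ κ 0 s) = C a * X f ^ d ∧
      (∀ e ∈ (CentreBlowup.step p Finset.univ κ 0 s).F.support, e f ≤ d - 1 → 2 ≤ e κ ∧ 2 ≤ e o) := by
  have hrdeg : s.r.degree = 2 := by rw [hr, map_add, Finsupp.degree_single, Finsupp.degree_single]
  have hrf : s.r f = 0 := by
    rw [hr, Finsupp.add_apply, Finsupp.single_eq_of_ne hκf.symm, Finsupp.single_eq_of_ne hof.symm, add_zero]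
  have hrdeg' : (CentreBlowup.step p Finset.univ κ 0 s).r.degree = 2 := by
    rw [hr', map_add, Finsupp.degree_single, Finsupp.degree_single]
  obtain ⟨haread, hstraight⟩ := straight_readings_of_resForm_prime ho hrdeg hform
  have htsch := tsch_row_of_ledger_prime hκo hκf hof hr (fun e he hef => (hled e he hef).2)
  -- F3 ∀ p (i)(ii): the child is straight with the same coefficient
  obtain ⟨hstraight', ha', -⟩ := cInf_legal_readings_of_corner_prime p hdp hd2 hκo hκf hof hr hdiv ho
    (by rw [haread]; exact ha) hstraight htsch ho' he3'
  have hform' : resForm (CentreBlowup.step p Finset.univ κ 0 s) = C a * X f ^ d := by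
    refine resForm_eq_C_mul_X_pow_of_readings_prime ho' hrdeg' ?_ ?_
    · rw [hr', ← hr, ha', haread]
    · intro m hm hne; rw [hr', ← hr]; exact hstraight' m hm hne
  -- FILE 2: the exact ledger rides
  have h7 := succ_le_degree_of_straight_prime (by omega) ho hdiv hrdeg hrf hstraight
  exact ⟨hform', ledger_step_zero_prime hκo hκf p hdp s h7 hled⟩

end Entry

end ResCone

end Summit.ResolutionOfSingularities.ResolutionOfSingularities.Theorems.PIDim4

end
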